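import Summits.BirchSwinnertonDyer.BirchSwinnertonDyer.Theorems.PrintCf2SplitBadTwoKummerBranchDichotomy
import Summits.BirchSwinnertonDyer.BirchSwinnertonDyer.Theorems.PrintCf2SplitBadTwoCMShaEigenImage
import Literature.NumberTheory.EllipticCurves.IwasawaCoinvariantsRankProofs
import HarnessLib

/-!
# Crux `PrintCf2.SplitBadTwoRankOneOfFacts` (stmt-BirchSwinnertonDyer-20368), road α v10.3, S3c residual (R-BV), input (H1′) — sequel to
# `…KummerBranchDichotomy`: the two KUMMER BOOKKEEPING inputs (S) «the Kummer image is `ι_* e_*`-stable» and (INF) «its `e′`-part is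
# infinite», the first PROVED, the second reduced to ONE arithmetic statement about `E(K)`

Cell `bsd-print-cf2`, EXTRA WIDTH seat `bsd-line-cf2-p1-w3` g9 (prover-bsd-line-cf2-p1-w3-g9-0); `--supports stmt-BirchSwinnertonDyer-20368`
(helper, Theses-free). HONEST FRAMING: nothing here closes the crux or a registered stub; BSD is not proved by any of this; no summit statement
is proved by this seat. No definition, no named fact, no `sorry`, no kit. beyond-print theorem: no.

WHAT. p671916 proved (H1′) «`Q_M = ι_*⁻¹(res_⊤ range κ) ≤ ker loc_v`» from `hfinB′`, the local cyclicity (T-loc), and two properties of the global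
Kummer image `Q = res_⊤(range κ) ≤ H¹(⊤, E[p^∞])`: (S) `ι_* e_* Q ⊆ Q` and (INF) `¬ Finite (e′_* Q)`. THIS FILE:
* §1 THE PROJECTOR AS A POLYNOMIAL IN `π` ON EACH LEVEL: for integers `N₁ ≡ r`, `N₂ ≡ r′ (mod p^k)` and `w` with `w (N₁ − N₂) ≡ 1 (mod p^k)`
  (they exist when `r − r′` is a `p`-adic unit, `exists_proj_levelData`), every `t ∈ E[p^∞]` with `p^k t = 0` has
  `ι (e t) = w • (π t − N₂ • t)` (`coe_proj_eq_zsmul_sub`) — from `t = ι e t + ι′ e′ t` and the eigen-conditions `π = N₁` on `W*[p^k]`,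
  `π = N₂` on `W*′[p^k]` (`mem_endEigenPrimaryTorsion_iff`).
* §2 (S) PROVED: `resH1Hom_subtype_proj_kummerMapLevel` — `ι_* e_* κ_N(P) = κ_N(P′)` for the `K`-point `P′` with
  `P′ = w • (π P − N₂ • P)` (the cocycle `σ ↦ ι e (σR − R)`, `p^N R = P`, IS the Kummer cocycle of `R′ = w • (π R − N₂ • R)`; `π P ∈ E(K)` by Galois
  descent `exists_toGeomPoints_eq_of_forall_smul_eq`); hence `resSubgroup_kummer_stable` — (S) VERBATIM as displayed in p671916
  (`κ(P ⊗ x)` for all `x ∈ ℚ_p/ℤ_p` via `exists_eq_tmul_prufGen`; `res_⊤` commutes with coefficient maps, `resH1Hom_comp_resSubgroup`).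
* §3 (INF) ⟸ (IND): `not_finite_map_proj_conj_kummer_of_forall` — `¬ Finite (e′_* Q)` as soon as (IND) «for every `m` there are a
  `K`-point `P₁` and a level `N` with `κ_N(w′ • (π (p^m • P₁) − N₁ • (p^m • P₁))) ≠ 0` for the level-`N` data `(N₁, N₂, w′)` of `e′`», i.e.
  «`π` is not congruent to the scalar `r` on `p^m E(K)` modulo `p^N E(K) +` torsion» — TRUE in `O_K`-rank `≥ 1` (`P`, `π P` independent; Mordell–Weil),
  discharged in the next file; a finite `e′_* Q` of exponent `p^m` would kill `e′_* κ_N(p^m P₁) = e′_*(p^m κ_N(P₁))`, contradicting (IND) through §2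
  for `e′` and the injectivity of `ι′_*`, `res_⊤`.
* §4 ASSEMBLY: `comap_kummer_le_ker_resOfLe_of_finite_conj_of_ind` — (H1′) ⟸ `hfinB′` ∧ (T-loc) ∧ (IND) ∧ `IsUnit (r − r′)` (on road α
  `r − r′ = 2r − 1`, `(2r − 1)² = −7`, a `2`-adic unit).

presearch: Greenberg LNM 1716 §2 (Kummer map and isogenies), Rubin LNM 1716 §2 (`E[𝔭^∞]`-decomposition) — functoriality folklore; nothing
to cite beyond the tree; no Literature fact filed.

References: [GreenbergLNM1716] §2; [Rubin1999] §2; [Agboola2007] §3, §6; [SerreGaloisCohomology1997] I §2.4; [SilvermanAEC2009] VIII §2.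
-/

noncomputable section

open scoped Classical

set_option linter.dupNamespace false
set_option autoImplicit false

open NumberField IsDedekindDomain Field WeierstrassCurve
open Literature.NumberTheory.EllipticCurves Literature.NumberTheory.EllipticCurves.GreenbergSelmer
open Literature.NumberTheory.EllipticCurves.Castella2018.AcSelmer
open Literature.NumberTheory.EllipticCurves.Agboola2007
open Literature.NumberTheory.EllipticCurves.ResKernel
open Literature.NumberTheory.GaloisRepresentations
open scoped TensorProduct

universe u

namespace Summit.BirchSwinnertonDyer.BirchSwinnertonDyer.Theorems.PrintCf2.RestrictedSelmerPair

open Summit.BirchSwinnertonDyer.Rank1Residual.X11b.Levels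
open Summit.BirchSwinnertonDyer.Rank1Residual.X11b.LocBridge
open Summit.BirchSwinnertonDyer.BirchSwinnertonDyer.Theorems.PrintCf2.CMPrimes

/-! ## §1. The projector as a polynomial in `π` on each level -/

section ProjFormula

variable {K : Type u} [Field K] (V : WeierstrassCurve K) (p : ℕ) [Fact p.Prime] (π : V.endRing) (r r' : ℤ_[p])

/-- **Level data for the projector.** If `r − r′` is a `p`-adic unit then for every `k` there are integers `N₁ ≡ r`, `N₂ ≡ r′ (mod p^k)` and
`w` with `w (N₁ − N₂) ≡ 1 (mod p^k)`. [folklore] -/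
theorem exists_proj_levelData (hunit : IsUnit (r - r')) (k : ℕ) :
    ∃ N₁ N₂ w : ℤ, ((N₁ : ℤ_[p]) - r) ∈ (Ideal.span {(p : ℤ_[p]) ^ k} : Ideal ℤ_[p]) ∧
      ((N₂ : ℤ_[p]) - r') ∈ (Ideal.span {(p : ℤ_[p]) ^ k} : Ideal ℤ_[p]) ∧
      (((w * (N₁ - N₂) : ℤ) : ℤ_[p]) - 1) ∈ (Ideal.span {(p : ℤ_[p]) ^ k} : Ideal ℤ_[p]) := by
  obtain ⟨N₁, hN₁⟩ := exists_int_sub_mem_span_pow p r k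
  obtain ⟨N₂, hN₂⟩ := exists_int_sub_mem_span_pow p r' k
  obtain ⟨u, hu⟩ := hunit
  obtain ⟨w, hw⟩ := exists_int_sub_mem_span_pow p ((u⁻¹ : ℤ_[p]ˣ) : ℤ_[p]) k
  refine ⟨N₁, N₂, w, hN₁, hN₂, ?_⟩
  -- `w (N₁ − N₂) − 1 = (w − u⁻¹)(N₁ − N₂) + u⁻¹ ((N₁ − r) − (N₂ − r′)) + (u⁻¹ u − 1)`
  have hdiff : ((N₁ : ℤ_[p]) - (N₂ : ℤ_[p]) - (u : ℤ_[p])) ∈ (Ideal.span {(p : ℤ_[p]) ^ k} : Ideal ℤ_[p]) := by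
    have := Ideal.sub_mem _ hN₁ hN₂
    rw [hu]
    convert this using 1
    ring
  have e : (((w * (N₁ - N₂) : ℤ) : ℤ_[p]) - 1) =
      (((w : ℤ_[p]) - ((u⁻¹ : ℤ_[p]ˣ) : ℤ_[p])) * ((N₁ : ℤ_[p]) - (N₂ : ℤ_[p])) +
        ((u⁻¹ : ℤ_[p]ˣ) : ℤ_[p]) * ((N₁ : ℤ_[p]) - (N₂ : ℤ_[p]) - (u : ℤ_[p]))) := by
    push_cast
    have hinv : ((u⁻¹ : ℤ_[p]ˣ) : ℤ_[p]) * (u : ℤ_[p]) = 1 := Units.inv_mul u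
    linear_combination hinv
  rw [e]
  exact Ideal.add_mem _ (Ideal.mul_mem_right _ _ hw) (Ideal.mul_mem_left _ _ hdiff)

/-- **`ι (e t) = w • (π t − N₂ • t)` on `E[p^∞][p^k]`** for complementary projectors `e`, `e′` (`ι e + ι′ e′ = id`) onto the eigen-summands
`E[𝔮_r^∞]`, `E[𝔮_{r′}^∞]` and level data `N₁ ≡ r`, `N₂ ≡ r′`, `w (N₁ − N₂) ≡ 1 (mod p^k)`: `π` acts as `N₁` on `W*[p^k]` and as `N₂` on `W*′[p^k]`.
[cite: Rubin1999, §2] -/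
theorem coe_proj_eq_zsmul_sub
    (e : V.geomPrimaryTorsion p →+ ↥(V.endEigenPrimaryTorsion p π r)) (e' : V.geomPrimaryTorsion p →+ ↥(V.endEigenPrimaryTorsion p π r'))
    (hsum : ∀ x, (e x : V.geomPrimaryTorsion p) + (e' x : V.geomPrimaryTorsion p) = x)
    {k : ℕ} {N₁ N₂ w : ℤ} (hN₁ : ((N₁ : ℤ_[p]) - r) ∈ (Ideal.span {(p : ℤ_[p]) ^ k} : Ideal ℤ_[p]))
    (hN₂ : ((N₂ : ℤ_[p]) - r') ∈ (Ideal.span {(p : ℤ_[p]) ^ k} : Ideal ℤ_[p]))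
    (hw : (((w * (N₁ - N₂) : ℤ) : ℤ_[p]) - 1) ∈ (Ideal.span {(p : ℤ_[p]) ^ k} : Ideal ℤ_[p]))
    (t : V.geomPrimaryTorsion p) (ht : p ^ k • t = 0) :
    (((e t : ↥(V.endEigenPrimaryTorsion p π r)) : V.geomPrimaryTorsion p) : V.geomPoints) =
      w • ((π : AddMonoid.End V.geomPoints) (t : V.geomPoints) - N₂ • (t : V.geomPoints)) := by
  set a : V.geomPrimaryTorsion p := (e t : V.geomPrimaryTorsion p) with ha
  set b : V.geomPrimaryTorsion p := (e' t : V.geomPrimaryTorsion p) with hb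
  have hab : a + b = t := hsum t
  -- `p^k` kills `a` and `b`
  have hka : p ^ k • a = 0 := by
    rw [ha, ← AddSubmonoidClass.coe_nsmul, ← map_nsmul, ht, map_zero, ZeroMemClass.coe_zero]
  have hkb : p ^ k • b = 0 := by
    rw [hb, ← AddSubmonoidClass.coe_nsmul, ← map_nsmul, ht, map_zero, ZeroMemClass.coe_zero]
  -- the eigen-conditions at level `k`
  have hπa : (π : AddMonoid.End V.geomPoints) (a : V.geomPoints) = N₁ • (a : V.geomPoints) :=
    (V.mem_endEigenPrimaryTorsion_iff (p := p) π r a).1 (e t).2 k N₁ hka hN₁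
  have hπb : (π : AddMonoid.End V.geomPoints) (b : V.geomPoints) = N₂ • (b : V.geomPoints) :=
    (V.mem_endEigenPrimaryTorsion_iff (p := p) π r' b).1 (e' t).2 k N₂ hkb hN₂
  -- `π t − N₂ t = (N₁ − N₂) a`
  have hka' : p ^ k • (a : V.geomPoints) = 0 := by rw [← AddSubmonoidClass.coe_nsmul, hka, ZeroMemClass.coe_zero]
  have h1 : (π : AddMonoid.End V.geomPoints) (t : V.geomPoints) - N₂ • (t : V.geomPoints) = (N₁ - N₂) • (a : V.geomPoints) := by
    rw [← hab, AddMemClass.coe_add, map_add, hπa, hπb, smul_add, sub_smul]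
    abel
  rw [h1, smul_smul, zsmul_eq_zsmul_of_approx' p hka' (r := 1) hw (N' := 1) (by simp), one_smul]

end ProjFormula

/-! ## §2. (S): the Kummer image is `ι_* e_*`-stable -/

section Stability

variable {K : Type u} [Field K] [NumberField K] (V : WeierstrassCurve K) [V.IsElliptic] (p : ℕ) [Fact p.Prime]
  (π : V.endRing) (r r' : ℤ_[p])

omit [V.IsElliptic] [Fact p.Prime] in
/-- `π P ∈ E(K)` for `P ∈ E(K)`: the `K`-rational endomorphism of a `K`-point is `Γ_K`-fixed (Galois descent). [cite: SilvermanAEC2009, III §4, VIII §1] -/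
theorem exists_toGeomPoints_eq_endRing_apply (P : V.toAffine.Point) :
    ∃ P₁ : V.toAffine.Point, toGeomPoints V P₁ = (π : AddMonoid.End V.geomPoints) (toGeomPoints V P) := by
  have hequiv := (V.mem_equivariantSubring_iff (π : AddMonoid.End V.geomPoints)).1 (Subring.mem_inf.1 π.2).2
  exact exists_toGeomPoints_eq_of_forall_smul_eq V fun σ ↦ by rw [← hequiv, smul_toGeomPoints]

omit [NumberField K] in
/-- **`ι_* e_* κ_N(P) = κ_N(P′)` with `P′ = w • (π P − N₂ • P)`** (Kummer classes at level `N`, on `H¹(Γ_K, E[p^∞])`): the cocycle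
`σ ↦ ι e (σR − R)` of a root `p^N R = P` is the Kummer cocycle of `R′ = w • (π R − N₂ • R)` (§1 on `E[p^N]`; `π` commutes with `Γ_K`).
[cite: GreenbergLNM1716, §2] [cite: SilvermanAEC2009, VIII §2] -/
theorem resH1Hom_subtype_proj_kummerMapLevel
    (e : V.geomPrimaryTorsion p →+ ↥(V.endEigenPrimaryTorsion p π r)) (e' : V.geomPrimaryTorsion p →+ ↥(V.endEigenPrimaryTorsion p π r'))
    (he : ∀ (σ : absoluteGaloisGroup K) (x : V.geomPrimaryTorsion p), e (σ • x) = σ • e x)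
    (hsum : ∀ x, (e x : V.geomPrimaryTorsion p) + (e' x : V.geomPrimaryTorsion p) = x)
    {N : ℕ} {N₁ N₂ w : ℤ} (hN₁ : ((N₁ : ℤ_[p]) - r) ∈ (Ideal.span {(p : ℤ_[p]) ^ N} : Ideal ℤ_[p]))
    (hN₂ : ((N₂ : ℤ_[p]) - r') ∈ (Ideal.span {(p : ℤ_[p]) ^ N} : Ideal ℤ_[p]))
    (hw : (((w * (N₁ - N₂) : ℤ) : ℤ_[p]) - 1) ∈ (Ideal.span {(p : ℤ_[p]) ^ N} : Ideal ℤ_[p]))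
    (P P₁ : V.toAffine.Point) (hP₁ : toGeomPoints V P₁ = (π : AddMonoid.End V.geomPoints) (toGeomPoints V P)) :
    resH1Hom (ContinuousMonoidHom.id (absoluteGaloisGroup K)) (V.endEigenPrimaryTorsion p π r).subtype (fun _ _ ↦ rfl)
        (resH1Hom (ContinuousMonoidHom.id (absoluteGaloisGroup K)) e (fun σ x ↦ he σ x)
          (V.kummerMapLevel p V.zsmul_geomPoints_surjective_holds N P)) =
      V.kummerMapLevel p V.zsmul_geomPoints_surjective_holds N (w • (P₁ - N₂ • P)) := by
  have hequiv := (V.mem_equivariantSubring_iff (π : AddMonoid.End V.geomPoints)).1 (Subring.mem_inf.1 π.2).2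
  -- a root `R` of `P` and the root `R′ = w • (π R − N₂ • R)` of `P′`
  set R := V.kummerRoot p V.zsmul_geomPoints_surjective_holds N P with hRdef
  have hR : p ^ N • R = toGeomPoints V P := V.nsmul_kummerRoot p V.zsmul_geomPoints_surjective_holds N P
  set R' : V.geomPoints := w • ((π : AddMonoid.End V.geomPoints) R - N₂ • R) with hR'def
  have hR' : p ^ N • R' = toGeomPoints V (w • (P₁ - N₂ • P)) := by
    rw [hR'def, smul_comm, smul_sub, ← map_nsmul, smul_comm (p ^ N) N₂, hR, ← hP₁, map_zsmul, map_sub, map_zsmul]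
  rw [V.kummerMapLevel_eq_kummerClass p V.zsmul_geomPoints_surjective_holds N P R hR,
    V.kummerMapLevel_eq_kummerClass p V.zsmul_geomPoints_surjective_holds N _ R' hR']
  unfold kummerClass
  rw [resH1Hom_oneCocycleClass', resH1Hom_oneCocycleClass']
  refine congrArg (oneCocycleClass _) (Subtype.ext (ContinuousMap.ext fun σ ↦ Subtype.ext ?_))
  change (((e ((V.kummerCocycle p N R (smul_nsmul_of_nsmul_eq V p hR)).1 σ) : ↥(V.endEigenPrimaryTorsion p π r)) :
      V.geomPrimaryTorsion p) : V.geomPoints) = σ • R' - R'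
  have ht : p ^ N • ((V.kummerCocycle p N R (smul_nsmul_of_nsmul_eq V p hR)).1 σ) = 0 := by
    apply Subtype.ext
    rw [AddSubmonoidClass.coe_nsmul, V.coe_kummerCocycle_apply, ZeroMemClass.coe_zero, smul_sub, smul_comm, hR, smul_toGeomPoints,
      sub_self]
  rw [coe_proj_eq_zsmul_sub V p π r r' e e' hsum hN₁ hN₂ hw _ ht, V.coe_kummerCocycle_apply]
  have hσ : σ • R' = w • ((π : AddMonoid.End V.geomPoints) (σ • R) - N₂ • (σ • R)) := by
    change DistribSMul.toAddMonoidHom V.geomPoints σ R' = _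
    rw [hR'def, map_zsmul, map_sub, map_zsmul]
    change w • (σ • (π : AddMonoid.End V.geomPoints) R - N₂ • (σ • R)) = _
    rw [hequiv]
  rw [hσ, hR'def, map_sub]
  generalize σ • R = C
  generalize (π : AddMonoid.End V.geomPoints) C = A
  generalize (π : AddMonoid.End V.geomPoints) R = B
  module

/-- **(S) VERBATIM as displayed in p671916: the global Kummer image `res_⊤(range κ) ≤ H¹(⊤, E[p^∞])` is `ι_* e_*`-stable** (granted
`IsUnit (r − r′)`): every element of `E(K) ⊗ ℚ_p/ℤ_p` is `P ⊗ [p^{-N}]`, `κ(P ⊗ [p^{-N}]) = κ_N(P)`, `ι_* e_* κ_N(P) = κ_N(P′)` (§2), and `res_⊤`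
commutes with coefficient maps. [cite: GreenbergLNM1716, §2] -/
theorem resSubgroup_kummer_stable (hunit : IsUnit (r - r'))
    (e : V.geomPrimaryTorsion p →+ ↥(V.endEigenPrimaryTorsion p π r)) (e' : V.geomPrimaryTorsion p →+ ↥(V.endEigenPrimaryTorsion p π r'))
    (he : ∀ (σ : absoluteGaloisGroup K) (x : V.geomPrimaryTorsion p), e (σ • x) = σ • e x)
    (hsum : ∀ x, (e x : V.geomPrimaryTorsion p) + (e' x : V.geomPrimaryTorsion p) = x) :
    ∀ q ∈ ((V.kummerMapPInfty p V.zsmul_geomPoints_surjective_holds).range).map (resSubgroup ⊤ (V.geomPrimaryTorsion p)),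
      resH1Hom (ContinuousMonoidHom.id (⊤ : Subgroup (absoluteGaloisGroup K))) (V.endEigenPrimaryTorsion p π r).subtype (fun _ _ ↦ rfl)
        (resH1Hom (ContinuousMonoidHom.id (⊤ : Subgroup (absoluteGaloisGroup K))) e (fun σ x ↦ he σ x) q) ∈
        ((V.kummerMapPInfty p V.zsmul_geomPoints_surjective_holds).range).map (resSubgroup ⊤ (V.geomPrimaryTorsion p)) := by
  rintro _ ⟨_, ⟨t, rfl⟩, rfl⟩
  obtain ⟨P, N, rfl⟩ := V.exists_eq_tmul_prufGen p t
  obtain ⟨N₁, N₂, w, hN₁, hN₂, hw⟩ := exists_proj_levelData p r r' hunit N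
  obtain ⟨P₁, hP₁⟩ := exists_toGeomPoints_eq_endRing_apply V π P
  refine ⟨V.kummerMapPInfty p V.zsmul_geomPoints_surjective_holds ((w • (P₁ - N₂ • P)) ⊗ₜ prufGen p N), ⟨_, rfl⟩, ?_⟩
  rw [V.kummerMapPInfty_tmul_prufGen, V.kummerMapPInfty_tmul_prufGen,
    ← resH1Hom_subtype_proj_kummerMapLevel V p π r r' e e' he hsum hN₁ hN₂ hw P P₁ hP₁]
  -- `res_⊤` commutes with `e_*` and with `ι_*`
  have hce := congrArg (fun f ↦ f (V.kummerMapLevel p V.zsmul_geomPoints_surjective_holds N P))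
    (resH1Hom_comp_resSubgroup (ContinuousMonoidHom.id (absoluteGaloisGroup K)) e (fun σ x ↦ he σ x) ⊤ ⊤
      (ContinuousMonoidHom.id (⊤ : Subgroup (absoluteGaloisGroup K))) (fun _ ↦ rfl) (fun σ x ↦ he σ x))
  have hcι := congrArg (fun f ↦ f (resH1Hom (ContinuousMonoidHom.id (absoluteGaloisGroup K)) e (fun σ x ↦ he σ x)
      (V.kummerMapLevel p V.zsmul_geomPoints_surjective_holds N P)))
    (resH1Hom_comp_resSubgroup (ContinuousMonoidHom.id (absoluteGaloisGroup K)) (V.endEigenPrimaryTorsion p π r).subtype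
      (fun _ _ ↦ rfl) ⊤ ⊤ (ContinuousMonoidHom.id (⊤ : Subgroup (absoluteGaloisGroup K))) (fun _ ↦ rfl) (fun _ _ ↦ rfl))
  simp only [AddMonoidHom.comp_apply] at hce hcι
  rw [← hcι, ← hce]

end Stability

/-! ## §3. (INF) from the arithmetic input (IND) -/

section Infinite

variable {K : Type u} [Field K] [NumberField K] (V : WeierstrassCurve K) [V.IsElliptic] (p : ℕ) [Fact p.Prime]
  (π : V.endRing) (r r' : ℤ_[p])

omit [Fact p.Prime] in
/-- A finite set of `p`-power-torsion elements of an abelian group has a common killing exponent. [folklore] -/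
theorem exists_pow_nsmul_eq_zero_of_finite_of_tors {A : Type*} [AddCommGroup A] (G : AddSubgroup A) [Finite G]
    (htors : ∀ g ∈ G, ∃ N : ℕ, p ^ N • g = 0) : ∃ m : ℕ, ∀ g ∈ G, p ^ m • g = 0 := by
  haveI : Fintype G := Fintype.ofFinite G
  choose k hk using fun g : G ↦ htors (g : A) g.2
  refine ⟨Finset.univ.sup k, fun g hg ↦ ?_⟩
  obtain ⟨d, hd⟩ := Nat.exists_eq_add_of_le (Finset.le_sup (f := k) (Finset.mem_univ (⟨g, hg⟩ : G)))
  rw [hd, pow_add, mul_comm, mul_smul, hk ⟨g, hg⟩, smul_zero]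

omit [NumberField K] in
/-- **(INF) ⟸ (IND).** If for every exponent `m` there are a `K`-point `P₁`, a level `N`, level data `(N₁ ≡ r′, N₂ ≡ r, w)` of the CONJUGATE
projector `e′` and the descended point `P₂` of `π (p^m P₁)` such that `κ_N(w • (P₂ − N₂ • (p^m • P₁))) ≠ 0` — i.e. `π ≢ r` on `p^m E(K)`
modulo `p^N E(K) +` torsion — then `e′_*(res_⊤ range κ)` is INFINITE: a finite one of exponent `p^m` would give
`ι′_* e′_* κ_N(p^m P₁) = p^m · (…) = 0`, but by §2 (for `e′`) that class is `κ_N(w • (P₂ − N₂ p^m P₁)) ≠ 0`, and `res_⊤` is injective.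
[cite: GreenbergLNM1716, §2] [cite: Agboola2007, §6] -/
theorem not_finite_map_proj_conj_kummer_of_forall
    (e : V.geomPrimaryTorsion p →+ ↥(V.endEigenPrimaryTorsion p π r)) (e' : V.geomPrimaryTorsion p →+ ↥(V.endEigenPrimaryTorsion p π r'))
    (he' : ∀ (σ : absoluteGaloisGroup K) (x : V.geomPrimaryTorsion p), e' (σ • x) = σ • e' x)
    (hsum : ∀ x, (e x : V.geomPrimaryTorsion p) + (e' x : V.geomPrimaryTorsion p) = x)
    (hind : ∀ m : ℕ, ∃ (P₁ P₂ : V.toAffine.Point) (N : ℕ) (N₁ N₂ w : ℤ),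
      ((N₁ : ℤ_[p]) - r') ∈ (Ideal.span {(p : ℤ_[p]) ^ N} : Ideal ℤ_[p]) ∧
      ((N₂ : ℤ_[p]) - r) ∈ (Ideal.span {(p : ℤ_[p]) ^ N} : Ideal ℤ_[p]) ∧
      (((w * (N₁ - N₂) : ℤ) : ℤ_[p]) - 1) ∈ (Ideal.span {(p : ℤ_[p]) ^ N} : Ideal ℤ_[p]) ∧
      toGeomPoints V P₂ = (π : AddMonoid.End V.geomPoints) (toGeomPoints V (p ^ m • P₁)) ∧
      V.kummerMapLevel p V.zsmul_geomPoints_surjective_holds N (w • (P₂ - N₂ • (p ^ m • P₁))) ≠ 0) :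
    ¬ Finite ↥((((V.kummerMapPInfty p V.zsmul_geomPoints_surjective_holds).range).map
        (resSubgroup ⊤ (V.geomPrimaryTorsion p))).map
          (resH1Hom (ContinuousMonoidHom.id (⊤ : Subgroup (absoluteGaloisGroup K))) e' (fun σ x ↦ he' σ x))) := by
  intro hfin
  set Q := ((V.kummerMapPInfty p V.zsmul_geomPoints_surjective_holds).range).map (resSubgroup ⊤ (V.geomPrimaryTorsion p)) with hQdef
  set e'T := resH1Hom (ContinuousMonoidHom.id (⊤ : Subgroup (absoluteGaloisGroup K))) e' (fun σ x ↦ he' σ x) with he'Tdef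
  set ι'T := resH1Hom (ContinuousMonoidHom.id (⊤ : Subgroup (absoluteGaloisGroup K))) (V.endEigenPrimaryTorsion p π r').subtype
    (fun _ _ ↦ rfl) with hι'Tdef
  -- a common killing exponent `p^m` of the finite `e′_* Q` (its elements are `p`-power torsion)
  have htors : ∀ g ∈ Q.map e'T, ∃ N : ℕ, p ^ N • g = 0 := by
    rintro _ ⟨_, ⟨c, -, rfl⟩, rfl⟩
    obtain ⟨N, hN⟩ := exists_pow_nsmul_eq_zero_of_primary (primaryGaloisModule V p)
      (fun Q' ↦ AddCommGroup.mem_primaryComponent.mp Q'.2 |>.imp fun k hk ↦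
        Subtype.ext (by rw [AddSubmonoidClass.coe_nsmul, hk, ZeroMemClass.coe_zero])) c
    have hN' : p ^ N • (c : V.galH1Primary p) = 0 := hN
    exact ⟨N, by rw [← map_nsmul, ← map_nsmul, hN', map_zero, map_zero]⟩
  haveI := hfin
  obtain ⟨m, hm⟩ := exists_pow_nsmul_eq_zero_of_finite_of_tors p (Q.map e'T) htors
  obtain ⟨P₁, P₂, N, N₁, N₂, w, hN₁, hN₂, hw, hP₂, hne⟩ := hind m
  -- `e′_* κ_N(p^m P₁) = p^m • e′_* κ_N(P₁) = 0`
  have hmem : e'T (resSubgroup ⊤ (V.geomPrimaryTorsion p) (V.kummerMapLevel p V.zsmul_geomPoints_surjective_holds N P₁)) ∈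
      Q.map e'T :=
    ⟨_, ⟨_, ⟨P₁ ⊗ₜ prufGen p N, by rw [V.kummerMapPInfty_tmul_prufGen]⟩, rfl⟩, rfl⟩
  have hzero : e'T (resSubgroup ⊤ (V.geomPrimaryTorsion p) (V.kummerMapLevel p V.zsmul_geomPoints_surjective_holds N (p ^ m • P₁))) = 0 := by
    rw [map_nsmul, map_nsmul, map_nsmul]
    exact hm _ hmem
  -- by §2 for `e′`: `ι′_* e′_* κ_N(p^m P₁) = κ_N(w • (P₂ − N₂ • p^m P₁))` on `H¹(Γ_K, E[p^∞])`
  have hsum' : ∀ x, (e' x : V.geomPrimaryTorsion p) + (e x : V.geomPrimaryTorsion p) = x := fun x ↦ by rw [add_comm]; exact hsum x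
  have key := resH1Hom_subtype_proj_kummerMapLevel V p π r' r e' e he' hsum' hN₁ hN₂ hw (p ^ m • P₁) P₂ hP₂
  -- transport to `⊤` and conclude `κ_N(…) = 0`
  have hce := congrArg (fun f ↦ f (V.kummerMapLevel p V.zsmul_geomPoints_surjective_holds N (p ^ m • P₁)))
    (resH1Hom_comp_resSubgroup (ContinuousMonoidHom.id (absoluteGaloisGroup K)) e' (fun σ x ↦ he' σ x) ⊤ ⊤
      (ContinuousMonoidHom.id (⊤ : Subgroup (absoluteGaloisGroup K))) (fun _ ↦ rfl) (fun σ x ↦ he' σ x))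
  have hcι := congrArg (fun f ↦ f (resH1Hom (ContinuousMonoidHom.id (absoluteGaloisGroup K)) e' (fun σ x ↦ he' σ x)
      (V.kummerMapLevel p V.zsmul_geomPoints_surjective_holds N (p ^ m • P₁))))
    (resH1Hom_comp_resSubgroup (ContinuousMonoidHom.id (absoluteGaloisGroup K)) (V.endEigenPrimaryTorsion p π r').subtype
      (fun _ _ ↦ rfl) ⊤ ⊤ (ContinuousMonoidHom.id (⊤ : Subgroup (absoluteGaloisGroup K))) (fun _ ↦ rfl) (fun _ _ ↦ rfl))
  simp only [AddMonoidHom.comp_apply] at hce hcι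
  have h0 : resSubgroup ⊤ (V.geomPrimaryTorsion p) (V.kummerMapLevel p V.zsmul_geomPoints_surjective_holds N (w • (P₂ - N₂ • (p ^ m • P₁)))) = 0 := by
    rw [← key, ← hcι, ← hce]
    change ι'T (e'T _) = 0
    rw [hzero, map_zero]
  have hinj : Function.Injective (resSubgroup ⊤ (V.geomPrimaryTorsion p)) :=
    (bijective_resH1Hom_subgroupIncl (G := absoluteGaloisGroup K) (↥(V.geomPrimaryTorsion p)) ⊤ (fun g ↦ Subgroup.mem_top g)).1
  exact hne (hinj (h0.trans (map_zero _).symm))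

end Infinite

/-! ## §4. Assembly: (H1′) from `hfinB′`, (T-loc), (IND) -/

section Assembly

variable {K : Type u} [Field K] [NumberField K] (V : WeierstrassCurve K) [V.IsElliptic] (p : ℕ) [Fact p.Prime]
  (π : V.endRing) (r r' : ℤ_[p]) (v : HeightOneSpectrum (𝓞 K))

/-- **(H1′) `Q_M ≤ ker loc_v` ⟸ `hfinB′` ∧ (T-loc) ∧ (IND)** on an imaginary quadratic base: p671916's `comap_kummer_le_ker_resOfLe_of_finite_conj`
with (S) discharged (`resSubgroup_kummer_stable`) and (INF) reduced to (IND) (`not_finite_map_proj_conj_kummer_of_forall`); the remaining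
inputs are the local cyclicity (T-loc) at `v`, the arithmetic (IND) on `E(K)`, and `hfinB′ = Finite 𝔖_v(K, E[𝔮_{r′}^∞])`.
[cite: Agboola2007, §6 (arXiv p0014:L5)] [cite: GreenbergLNM1716, §2 Prop. 2.1] -/
theorem comap_kummer_le_ker_resOfLe_of_finite_conj_of_ind (hK : IsImaginaryQuadratic K) (hunit : IsUnit (r - r'))
    (hinf : V.endEigenPrimaryTorsion p π r ⊓ V.endEigenPrimaryTorsion p π r' = ⊥)
    (hsup : V.endEigenPrimaryTorsion p π r ⊔ V.endEigenPrimaryTorsion p π r' = ⊤)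
    (e : V.geomPrimaryTorsion p →+ ↥(V.endEigenPrimaryTorsion p π r)) (e' : V.geomPrimaryTorsion p →+ ↥(V.endEigenPrimaryTorsion p π r'))
    (he₁ : ∀ x : ↥(V.endEigenPrimaryTorsion p π r), e x = x)
    (he : ∀ (σ : absoluteGaloisGroup K) (x : V.geomPrimaryTorsion p), e (σ • x) = σ • e x)
    (he'₁ : ∀ x : ↥(V.endEigenPrimaryTorsion p π r'), e' x = x) (he'₂ : ∀ x ∈ V.endEigenPrimaryTorsion p π r, e' x = 0)
    (he' : ∀ (σ : absoluteGaloisGroup K) (x : V.geomPrimaryTorsion p), e' (σ • x) = σ • e' x)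
    (hsum : ∀ x, (e x : V.geomPrimaryTorsion p) + (e' x : V.geomPrimaryTorsion p) = x)
    (hind : ∀ m : ℕ, ∃ (P₁ P₂ : V.toAffine.Point) (N : ℕ) (N₁ N₂ w : ℤ),
      ((N₁ : ℤ_[p]) - r') ∈ (Ideal.span {(p : ℤ_[p]) ^ N} : Ideal ℤ_[p]) ∧
      ((N₂ : ℤ_[p]) - r) ∈ (Ideal.span {(p : ℤ_[p]) ^ N} : Ideal ℤ_[p]) ∧
      (((w * (N₁ - N₂) : ℤ) : ℤ_[p]) - 1) ∈ (Ideal.span {(p : ℤ_[p]) ^ N} : Ideal ℤ_[p]) ∧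
      toGeomPoints V P₂ = (π : AddMonoid.End V.geomPoints) (toGeomPoints V (p ^ m • P₁)) ∧
      V.kummerMapLevel p V.zsmul_geomPoints_surjective_holds N (w • (P₂ - N₂ • (p ^ m • P₁))) ≠ 0)
    (hcyc : ∀ x ∈ (((V.kummerMapPInfty p V.zsmul_geomPoints_surjective_holds).range).map (resSubgroup ⊤ (V.geomPrimaryTorsion p))).map
        (resOfLe (V.geomPrimaryTorsion p) (inf_le_left : ⊤ ⊓ decomp v ≤ ⊤)),
      ∀ y ∈ (((V.kummerMapPInfty p V.zsmul_geomPoints_surjective_holds).range).map (resSubgroup ⊤ (V.geomPrimaryTorsion p))).map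
        (resOfLe (V.geomPrimaryTorsion p) (inf_le_left : ⊤ ⊓ decomp v ≤ ⊤)),
      p • x = 0 → p • y = 0 → x ≠ 0 → ∃ m : ℤ, y = m • x)
    (hfin' : Finite (restrictedSelmerBase ↥(V.endEigenPrimaryTorsion p π r') p v)) :
    (((V.kummerMapPInfty p V.zsmul_geomPoints_surjective_holds).range).map (resSubgroup ⊤ (V.geomPrimaryTorsion p))).comap
        (resH1Hom (ContinuousMonoidHom.id (⊤ : Subgroup (absoluteGaloisGroup K))) (V.endEigenPrimaryTorsion p π r).subtype
          (fun _ _ ↦ rfl)) ≤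
      (resOfLe ↥(V.endEigenPrimaryTorsion p π r) (inf_le_left : ⊤ ⊓ decomp v ≤ ⊤)).ker :=
  comap_kummer_le_ker_resOfLe_of_finite_conj V p π r r' v hK hinf hsup e e' he₁ he he'₁ he'₂ he' hsum
    (resSubgroup_kummer_stable V p π r r' hunit e e' he hsum)
    (not_finite_map_proj_conj_kummer_of_forall V p π r r' e e' he' hsum hind) hcyc hfin'

end Assembly

end Summit.BirchSwinnertonDyer.BirchSwinnertonDyer.Theorems.PrintCf2.RestrictedSelmerPair

end
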